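import Literature.ModelTheory.ExponentialFields.CylindricalDecompositionProofs
import Literature.NumberTheory.Transcendental.SemialgebraicMaps

/-!
# `SectorToKernel`, line `effective-cube-surjection`: refining the base of a cylindrical decomposition

Crux `FurushoPentagon.SectorToKernel` (stmt-KontsevichZagierPeriods-10813), line
`effective-cube-surjection`, stub C `stub_cadRefine` of the lead's skeleton v6 (consumed by the
lead's induction `stub_nashCellReductionOf`).

Let `𝒯` be a finite partition of `ℝⁿ⁺¹` into `ℚ`-semialgebraic sets which is the stack of graphs and
bands of strictly increasing, continuous, `ℚ`-semialgebraic sections `ξ_S` over the cells `S` of a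
cylindrical decomposition `𝒮` of `ℝⁿ` (Basu–Pollack–Roy, Def. 5.1, the tree's
`IsCylindricalDecomposition` / `graphOver` / `bandOver`), and let `𝒮'` be a cylindrical
decomposition of `ℝⁿ` refining `𝒮`.  Every cell `S' ∈ 𝒮'` lies in a *parent* `S ∈ 𝒮` (cells of a
partition are nonempty; a point of `S'` lies in some `S ∈ 𝒮`, which is a union of cells of `𝒮'`,
one of which contains the point and hence IS `S'`); the parent is unique because `𝒮` is a partition.
Restricting the sections of the parent to `S'` gives the stack `𝒯'` over `𝒮'`:

* `𝒯'` is a finite partition of `ℝⁿ⁺¹` — the stack over a partition is a partition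
  (`CylindricalDecomposition.isPartition_of_mem_iff`);
* its cells are `ℚ`-semialgebraic — a new cell is an old cell cut by the cylinder over `S'`
  (`cadRefine_graphOver_inter`, `cadRefine_bandOver_inter`, `IsSemialgebraic.setOf_init_mem`);
* the sections are the SAME functions, so continuity / semialgebraicity / monotonicity restrict;
* every old cell `T` is the union of the new cells contained in it: the new cell through a point
  `z ∈ T` lies over some `S'` whose parent contains `Fin.init z`, hence is the base of `T`, and two
  cells of the same sections sharing a point lie one inside the other (`cadRefine_subset_of_mem`).

## References

* S. Basu, R. Pollack, M.-F. Roy, *Algorithms in Real Algebraic Geometry*, 2nd ed. (2006), Def. 5.1,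
  Rem. 5.2. [BasuPollackRoy2006]
-/

noncomputable section

namespace Summit.KontsevichZagierPeriods.FurushoPentagon.SectorToKernel

open Set
open Literature.ModelTheory.ExponentialFields
open Literature.ModelTheory.ExponentialFields.CylindricalDecomposition
open Literature.NumberTheory.Transcendental

/-- A graph over `S' ⊆ S` is the graph (of the same function) over `S` cut by the cylinder over
`S'`. [cite: BasuPollackRoy2006, Def. 5.1] -/
theorem cadRefine_graphOver_inter {n : ℕ} {S S' : Set (Fin n → ℝ)} (h : S' ⊆ S)
    (f : (Fin n → ℝ) → ℝ) :
    graphOver S f ∩ {z | Fin.init z ∈ S'} = graphOver S' f := by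
  ext z
  simp only [mem_inter_iff, mem_graphOver_iff, mem_setOf_eq]
  exact ⟨fun hz => ⟨hz.2, hz.1.2⟩, fun hz => ⟨⟨h hz.1, hz.2⟩, hz.1⟩⟩

/-- A band over `S' ⊆ S` is the band (of the same sections, same index) over `S` cut by the
cylinder over `S'`. [cite: BasuPollackRoy2006, Def. 5.1] -/
theorem cadRefine_bandOver_inter {n l : ℕ} {S S' : Set (Fin n → ℝ)} (h : S' ⊆ S)
    (ξ : Fin l → (Fin n → ℝ) → ℝ) (j : Fin (l + 1)) :
    bandOver S ξ j ∩ {z | Fin.init z ∈ S'} = bandOver S' ξ j := by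
  ext z
  simp only [mem_inter_iff, mem_bandOver_iff, mem_setOf_eq]
  exact ⟨fun hz => ⟨hz.2, hz.1.2⟩, fun hz => ⟨⟨h hz.1, hz.2⟩, hz.1⟩⟩

/-- Two cells of the SAME strictly increasing sections, one over `S` and one over `S' ⊆ S`, that
share a point: the cell over `S'` is contained in the cell over `S` (graphs of distinct sections are
disjoint, a section value lies in no band, and two bands with a common point coincide).
[cite: BasuPollackRoy2006, Def. 5.1 and Rem. 5.2] -/
theorem cadRefine_subset_of_mem {n l : ℕ} {S S' : Set (Fin n → ℝ)} (hsub : S' ⊆ S)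
    {ξ : Fin l → (Fin n → ℝ) → ℝ} (hmono : ∀ x ∈ S, StrictMono fun j => ξ j x)
    {T T' : Set (Fin (n + 1) → ℝ)}
    (hT : (∃ j, T = graphOver S (ξ j)) ∨ ∃ j, T = bandOver S ξ j)
    (hT' : (∃ j, T' = graphOver S' (ξ j)) ∨ ∃ j, T' = bandOver S' ξ j)
    {z : Fin (n + 1) → ℝ} (hz : z ∈ T) (hz' : z ∈ T') : T' ⊆ T := by
  rcases hT with ⟨j, rfl⟩ | ⟨j, rfl⟩ <;> rcases hT' with ⟨j', rfl⟩ | ⟨j', rfl⟩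
  · obtain ⟨hx, ht⟩ := mem_graphOver_iff.mp hz
    obtain ⟨-, ht'⟩ := mem_graphOver_iff.mp hz'
    obtain rfl : j = j' := (hmono _ hx).injective (ht.symm.trans ht')
    exact fun w hw => ⟨hsub hw.1, hw.2⟩
  · obtain ⟨hx, ht⟩ := mem_graphOver_iff.mp hz
    obtain ⟨-, ht'⟩ := mem_bandOver_iff.mp hz'
    exact absurd ht' (not_mem_band_of_eq ξ (Fin.init z) (hmono _ hx) ht)
  · obtain ⟨hx, ht⟩ := mem_bandOver_iff.mp hz
    obtain ⟨-, ht'⟩ := mem_graphOver_iff.mp hz'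
    exact absurd ht (not_mem_band_of_eq ξ (Fin.init z) (hmono _ hx) ht')
  · obtain ⟨hx, ht⟩ := mem_bandOver_iff.mp hz
    obtain ⟨-, ht'⟩ := mem_bandOver_iff.mp hz'
    obtain rfl : j = j' := band_eq_band ξ (Fin.init z) (hmono _ hx) ht ht'
    exact fun w hw => ⟨hsub hw.1, hw.2⟩

/-- **C — refining the base of a cylindrical decomposition.** Let `𝒯` be a finite partition of `ℝⁿ⁺¹` into
`ℚ`-semialgebraic sets which is the stack of the sections `ξ_S` (`S ∈ 𝒮`) over a cylindrical decomposition
`𝒮` of `ℝⁿ`, and let `𝒮'` be a cylindrical decomposition of `ℝⁿ` refining `𝒮` (every `S ∈ 𝒮` is a union of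
cells of `𝒮'`).  Then the graphs and bands over the cells `S' ∈ 𝒮'` of the sections of the unique `S ⊇ S'`
form a finite partition `𝒯'` of `ℝⁿ⁺¹` into `ℚ`-semialgebraic sets, the stack over `𝒮'` of sections that
AGREE with the old ones, and every `T ∈ 𝒯` is a union of cells of `𝒯'`. [cite: BasuPollackRoy2006, Def. 5.1 and Rem. 5.2] -/
theorem stub_cadRefine : ∀ {n : ℕ} (𝒮 𝒮' : Finset (Set (Fin n → ℝ))) (𝒯 : Finset (Set (Fin (n + 1) → ℝ)))
    (l : Set (Fin n → ℝ) → ℕ) (ξ : (S : Set (Fin n → ℝ)) → Fin (l S) → (Fin n → ℝ) → ℝ),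
    Setoid.IsPartition (𝒯 : Set (Set (Fin (n + 1) → ℝ))) → (∀ T ∈ 𝒯, IsSemialgebraic ℚ T) →
    IsCylindricalDecomposition ℚ n 𝒮 →
    (∀ S ∈ 𝒮, ∀ j, ContinuousOn (ξ S j) S) → (∀ S ∈ 𝒮, ∀ j, IsSemialgebraicFunOn ℚ S (ξ S j)) →
    (∀ S ∈ 𝒮, ∀ x ∈ S, StrictMono fun j => ξ S j x) →
    (∀ T, T ∈ 𝒯 ↔ ∃ S ∈ 𝒮, (∃ j, T = graphOver S (ξ S j)) ∨ ∃ j, T = bandOver S (ξ S) j) →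
    IsCylindricalDecomposition ℚ n 𝒮' → (∀ S ∈ 𝒮, ∃ 𝒞 ⊆ 𝒮', ⋃₀ (𝒞 : Set (Set (Fin n → ℝ))) = S) →
    ∃ (𝒯' : Finset (Set (Fin (n + 1) → ℝ))) (l' : Set (Fin n → ℝ) → ℕ)
      (ξ' : (S : Set (Fin n → ℝ)) → Fin (l' S) → (Fin n → ℝ) → ℝ),
      Setoid.IsPartition (𝒯' : Set (Set (Fin (n + 1) → ℝ))) ∧ (∀ T ∈ 𝒯', IsSemialgebraic ℚ T) ∧
      (∀ S ∈ 𝒮', ∀ j, ContinuousOn (ξ' S j) S) ∧ (∀ S ∈ 𝒮', ∀ j, IsSemialgebraicFunOn ℚ S (ξ' S j)) ∧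
      (∀ S ∈ 𝒮', ∀ x ∈ S, StrictMono fun j => ξ' S j x) ∧
      (∀ T, T ∈ 𝒯' ↔ ∃ S ∈ 𝒮', (∃ j, T = graphOver S (ξ' S j)) ∨ ∃ j, T = bandOver S (ξ' S) j) ∧
      (∀ T ∈ 𝒯, ∃ 𝒞 ⊆ 𝒯', ⋃₀ (𝒞 : Set (Set (Fin (n + 1) → ℝ))) = T) ∧
      (∀ S' ∈ 𝒮', ∃ S ∈ 𝒮, S' ⊆ S ∧ ∃ h : l' S' = l S, ∀ j, ∀ x ∈ S', ξ' S' j x = ξ S (Fin.cast h j) x) := by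
  intro n 𝒮 𝒮' 𝒯 l ξ _h𝒯part h𝒯sa h𝒮 hcont hsa hmono hmem h𝒮' href
  classical
  have hpart := h𝒮.isPartition
  have hpart' := h𝒮'.isPartition
  have hne' : ∀ S' ∈ 𝒮', S'.Nonempty := fun S' hS' =>
    Set.nonempty_iff_ne_empty.mpr fun h => hpart'.1 (by rw [Finset.mem_coe, ← h]; exact hS')
  -- every cell of `𝒮'` lies in a (unique) parent cell of `𝒮`
  have hex : ∀ S' ∈ 𝒮', ∃ S ∈ 𝒮, S' ⊆ S := by
    intro S' hS'
    obtain ⟨x, hx⟩ := hne' S' hS'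
    obtain ⟨S, ⟨hS, hxS⟩, -⟩ := hpart.2 x
    rw [Finset.mem_coe] at hS
    obtain ⟨𝒞, h𝒞, hU⟩ := href S hS
    have hxU : x ∈ ⋃₀ (𝒞 : Set (Set (Fin n → ℝ))) := by rw [hU]; exact hxS
    obtain ⟨C, hC, hxC⟩ := mem_sUnion.1 hxU
    obtain ⟨U, -, huniq⟩ := hpart'.2 x
    have hCS' : C = S' :=
      (huniq C ⟨Finset.mem_coe.2 (h𝒞 (Finset.mem_coe.1 hC)), hxC⟩).trans
        (huniq S' ⟨Finset.mem_coe.2 hS', hx⟩).symm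
    refine ⟨S, hS, ?_⟩
    rw [← hCS', ← hU]
    exact subset_sUnion_of_mem hC
  choose! par hparmem hparsub using hex
  -- the restricted stack
  have hmono' : ∀ S ∈ 𝒮', ∀ x ∈ S, StrictMono fun j => ξ (par S) j x :=
    fun S hS x hx => hmono (par S) (hparmem S hS) x (hparsub S hS hx)
  have hcont' : ∀ S ∈ 𝒮', ∀ j, ContinuousOn (ξ (par S) j) S :=
    fun S hS j => (hcont (par S) (hparmem S hS) j).mono (hparsub S hS)
  have hsa' : ∀ S ∈ 𝒮', ∀ j, IsSemialgebraicFunOn ℚ S (ξ (par S) j) :=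
    fun S hS j => (hsa (par S) (hparmem S hS) j).mono (hparsub S hS) (h𝒮'.isSemialgebraic S hS)
  set 𝒯' : Finset (Set (Fin (n + 1) → ℝ)) := 𝒮'.biUnion fun S =>
    (Finset.univ.image fun j : Fin (l (par S)) => graphOver S (ξ (par S) j)) ∪
      (Finset.univ.image fun j : Fin (l (par S) + 1) => bandOver S (ξ (par S)) j) with h𝒯'def
  have h𝒯' : ∀ T, T ∈ 𝒯' ↔
      ∃ S ∈ 𝒮', (∃ j, T = graphOver S (ξ (par S) j)) ∨ ∃ j, T = bandOver S (ξ (par S)) j := by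
    intro T
    simp only [h𝒯'def, Finset.mem_biUnion, Finset.mem_union, Finset.mem_image, Finset.mem_univ,
      true_and]
    constructor
    · rintro ⟨S, hS, ⟨j, hj⟩ | ⟨j, hj⟩⟩
      · exact ⟨S, hS, Or.inl ⟨j, hj.symm⟩⟩
      · exact ⟨S, hS, Or.inr ⟨j, hj.symm⟩⟩
    · rintro ⟨S, hS, ⟨j, hj⟩ | ⟨j, hj⟩⟩
      · exact ⟨S, hS, Or.inl ⟨j, hj.symm⟩⟩
      · exact ⟨S, hS, Or.inr ⟨j, hj.symm⟩⟩
  -- it is a partition of `ℝⁿ⁺¹`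
  have h𝒯'part : Setoid.IsPartition (𝒯' : Set (Set (Fin (n + 1) → ℝ))) :=
    isPartition_of_mem_iff (l := fun S => l (par S)) (ξ := fun S => ξ (par S)) h𝒯' hpart' hmono'
  -- into `ℚ`-semialgebraic cells
  have h𝒯'sa : ∀ T ∈ 𝒯', IsSemialgebraic ℚ T := by
    intro T hT
    obtain ⟨S', hS', hTc⟩ := (h𝒯' T).1 hT
    have hcyl : IsSemialgebraic ℚ {z : Fin (n + 1) → ℝ | Fin.init z ∈ S'} :=
      (h𝒮'.isSemialgebraic S' hS').setOf_init_mem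
    rcases hTc with ⟨j, rfl⟩ | ⟨j, rfl⟩
    · rw [← cadRefine_graphOver_inter (hparsub S' hS')]
      exact (h𝒯sa _ ((hmem _).2 ⟨par S', hparmem S' hS', Or.inl ⟨j, rfl⟩⟩)).inter hcyl
    · rw [← cadRefine_bandOver_inter (hparsub S' hS')]
      exact (h𝒯sa _ ((hmem _).2 ⟨par S', hparmem S' hS', Or.inr ⟨j, rfl⟩⟩)).inter hcyl
  -- every old cell is the union of the new cells it contains
  have href' : ∀ T ∈ 𝒯, ∃ 𝒞 ⊆ 𝒯', ⋃₀ (𝒞 : Set (Set (Fin (n + 1) → ℝ))) = T := by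
    intro T hT
    refine ⟨𝒯'.filter fun T' => T' ⊆ T, Finset.filter_subset _ _, subset_antisymm ?_ ?_⟩
    · intro z hz
      obtain ⟨T', hT', hzT'⟩ := mem_sUnion.1 hz
      exact (Finset.mem_filter.1 (Finset.mem_coe.1 hT')).2 hzT'
    · intro z hz
      obtain ⟨T', ⟨hT'mem, hzT'⟩, -⟩ := h𝒯'part.2 z
      rw [Finset.mem_coe] at hT'mem
      refine mem_sUnion.2 ⟨T', Finset.mem_coe.2 (Finset.mem_filter.2 ⟨hT'mem, ?_⟩), hzT'⟩
      obtain ⟨S, hS, hTc⟩ := (hmem T).1 hT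
      obtain ⟨S', hS', hT'c⟩ := (h𝒯' T').1 hT'mem
      have hzS : Fin.init z ∈ S := by
        rcases hTc with ⟨j, rfl⟩ | ⟨j, rfl⟩
        · exact (mem_graphOver_iff.1 hz).1
        · exact (mem_bandOver_iff.1 hz).1
      have hzS' : Fin.init z ∈ S' := by
        rcases hT'c with ⟨j, rfl⟩ | ⟨j, rfl⟩
        · exact (mem_graphOver_iff.1 hzT').1
        · exact (mem_bandOver_iff.1 hzT').1
      obtain rfl : S = par S' := by
        obtain ⟨U, -, huniq⟩ := hpart.2 (Fin.init z)
        exact (huniq S ⟨Finset.mem_coe.2 hS, hzS⟩).trans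
          (huniq (par S') ⟨Finset.mem_coe.2 (hparmem S' hS'), hparsub S' hS' hzS'⟩).symm
      exact cadRefine_subset_of_mem (hparsub S' hS') (hmono _ hS) hTc hT'c hz hzT'
  exact ⟨𝒯', fun S => l (par S), fun S => ξ (par S), h𝒯'part, h𝒯'sa, hcont', hsa', hmono', h𝒯',
    href', fun S' hS' => ⟨par S', hparmem S' hS', hparsub S' hS', rfl, fun j x _ => rfl⟩⟩

end Summit.KontsevichZagierPeriods.FurushoPentagon.SectorToKernel
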